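import Mathlib
import HarnessLib
import Summits.NavierStokesRegularity.NavierStokesRegularity.Theorems.PoloidalWindowDoorPoloidalWindowRigidityStructureFunctionDynamics
import Summits.NavierStokesRegularity.NavierStokesRegularity.Theorems.PoloidalWindowDoorPoloidalWindowRigidityUntwistedKinematics
import Literature.Analysis.FluidPDE.SpaceTimeMixedPartials

/-!
# Route `PoloidalWindowDoor`, crux `PoloidalWindowRigidity` (K2, stmt-NavierStokesRegularity-19708), skeleton `lrc-jet` v5,
# stub `stub_untwisted` — brick F2b: the three POINTWISE IDENTITIES of the structure-function normal form of poloidal Navier–Stokes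
# ((K1) divergence, (Sz) transport rule, (V0) vertical momentum) for GIVEN structure functions

Cell ns-regularity-ideate, seat ns-poloidal-K2-p2 (gen 5; stub-worker under the K2 lead ns-poloidal-K2-p1 g6; file landed
`--supports stmt-NavierStokesRegularity-19708` as a helper toward the registered stub `stub_untwisted`; brick F2 of the lead's
`BRIEF-v5-bricks-v2.md` (S5); paper source `Cruxes/PoloidalWindowRigidity/UNTWISTED-NOTE.md` §1).  Sequel of `…StructureFunctionDynamics`
(F2a: the dynamic scalar `T = ∂ₜψ + (v·∇)ψ − Δψ` is leafwise; Laplacian / time chain rules).  Here the three identities of the normal form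
are proved AT A POINT of an open set `U` of one slice, for GIVEN structure functions `P` (untwisted: `∂₂w = P(w,y₂)`, `w = v₂(t,·)`),
`Λ` (shear slope: `∂₂v_b = Λ(w,y₂)∂_bw`, `b = 0,1`) and `F` (stream function `ψ = F(w,y₂)`, `Λ = 1 − F_w`), in EXACTLY the hypothesis
format (`hK1`, `hSz`, `hV0`) of the lead's separation files `…UntwistedSeparation{,2}`; the packaged existence statement (class profile +
non-degenerate untwisted window ⇒ `∃ U, P, Λ, c, k, p_t` with all identities and `Cⁿ` regularity) is the next file.  Indices `0,1`
horizontal, `2` the height; `E = (∂₀w)² + (∂₁w)²`, `M = ∂₀∂₀w + ∂₁∂₁w`, `S = v₀∂₀w + v₁∂₁w + ∂ₜw` (two-sided `∂ₜ`, `t < 0`).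

* `fderiv_timeSlice_apply`, `contDiffAt_timeSlice` — the time slice `F = F̃(t,·,·)` of a space–time structure function: `DF(p)u = DF̃(t,p)(0,u)`.
* `sum_fderiv_apply_eq_zero_of_isDivFree` — `div V = Σᵢ(DV eᵢ)ᵢ = 0` in coordinates.
* `divIdentity_of_structureFunctions` — **(K1)**: `V ∈ C²` divergence-free, `∂₂V₂ = P(V₂,y₂)` and `∂₂V_b = Λ(V₂,y₂)∂_bV₂` on an open `U`
  ⇒ `Λ·M + Λ_w·E + Ṗ = 0` on `U` (`Ṗ = DP(P,1)`; the `e₂`-derivative of `div V = 0`: `∂₂∂_bV_b = ∂_b(Λ∂_bw)`, `∂₂∂₂w = Ṗ`).  So `hK1` holds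
  with `c := Ṗ`.
* `isSmoothSpaceTimeOn_vert`, `contDiff_timeDeriv_vert`, `fderiv_timeDeriv_vert` — the vertical velocity of a class profile as a jointly
  smooth scalar field; `y ↦ ∂ₜv₂(t,y)` is smooth; mixed partials `∂₂∂ₜv₂ = ∂ₜ∂₂v₂` (tree `SpaceTimeMixedPartials`).
* `transport_rule` — **(Sz)**: class profile, `∂₂w = P(w,y₂)` and `∂₂v_b = Λ∂_bw` on an open `U`, and at `y ∈ U` the time line of `∂₂v₂` has
  derivative `P_t + P_w∂ₜw` (chain rule of a space–time `P̃`) ⇒ `∂₂S = P_w·S + Λ·E + P_t` at `y`.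
* `dynIdentity` — **(V0)**: class profile, poloidal, time-dependent Clebsch pair `φ, ψ`; on an open `U` of the slice `t`: `ψ = F(w,y₂)` (`F ∈ C²`
  at the leaf points), `∂₂w = P(w,y₂)`; at `y ∈ U`: the time/space chain rules of `ψ = F̃(τ,w,y₂)` and `T(t,y) = τ(w y, y₂)` ⇒ with
  `Λ := 1 − F_w`:  **`(1−Λ)·S = (1−Λ)·M − Λ_w·E + k`**, `k = τ − F_t − F_w·wP − w·F_z + F_w·Ṗ + F_ww·P² + (F_wz + F_zw)·P + F_zz` — an explicit
  function of `(w, y₂)`.  This is UNTWISTED-NOTE §1 (V0) (there `K := F_zz − F_t − Π_z + β_z`; the pressure gauge `β(z,t)` is hidden in `τ`),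
  obtained WITHOUT the pressure and without the velocity-gradient law: `T` is leafwise by (E2) + frozen constraint (F2a), and
  `T = 𝓛[F(t,w,y₂)] = F_w·𝓛w + …` by the chain rules.

WHAT THIS IS NOT: not a claim about Navier–Stokes regularity and not the stub — calculus/normal-form bookkeeping for `stub_untwisted`
(bears_on LADDER-NS N0 via crux K2 = stmt-19708).
-/

noncomputable section

-- the summit and its single sub-problem share the name (CONVENTIONS §1), as in every Theorems file
set_option linter.dupNamespace false

namespace Summit.NavierStokesRegularity.NavierStokesRegularity.Theorems.PoloidalWindowDoorPoloidalWindowRigidityStructureFunctionNormalForm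

open Set Function Filter Topology Metric
open scoped RealInnerProductSpace InnerProductSpace Laplacian ContDiff
open Literature.Analysis Literature.Analysis.FluidPDE Literature.Analysis.Calculus
open Literature.Geometry.Riemannian (clm_prod_apply_eq)
open Summit.NavierStokesRegularity.NavierStokesRegularity.Theorems.PoloidalWindowDoorPoloidalWindowRigidityConstantShearMeans
open Summit.NavierStokesRegularity.NavierStokesRegularity.Theorems.PoloidalWindowDoorLrcModEntireLeafwiseVertical
open Summit.NavierStokesRegularity.NavierStokesRegularity.Theorems.PoloidalWindowDoorPoloidalWindowRigidityUntwistedSeparation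
open Summit.NavierStokesRegularity.NavierStokesRegularity.Theorems.PoloidalWindowDoorPoloidalWindowRigidityUntwistedKinematics
open Summit.NavierStokesRegularity.NavierStokesRegularity.Theorems.PoloidalWindowDoorPoloidalWindowRigidityStructureFunctionDynamics

/-! ### Time slices of a space–time structure function `G(t, a, z)` -/

/-- The time slice `q ↦ G(t, q)` of a space–time structure function: `D[G(t,·)](p) u = DG(t,p)(0, u)`. [folklore] -/
theorem fderiv_timeSlice_apply {G : ℝ × ℝ × ℝ → ℝ} {t : ℝ} {p : ℝ × ℝ} (hG : DifferentiableAt ℝ G (t, p.1, p.2)) (u : ℝ × ℝ) :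
    fderiv ℝ (fun q : ℝ × ℝ => G (t, q.1, q.2)) p u = fderiv ℝ G (t, p.1, p.2) ((0 : ℝ), u.1, u.2) := by
  have hι : HasFDerivAt (fun q : ℝ × ℝ => ((t, q) : ℝ × ℝ × ℝ)) (ContinuousLinearMap.inr ℝ ℝ (ℝ × ℝ)) p :=
    hasFDerivAt_prodMk_right t p
  have hc := (hG.hasFDerivAt.comp p hι).fderiv
  have e : (fun q : ℝ × ℝ => G (t, q.1, q.2)) = G ∘ fun q : ℝ × ℝ => ((t, q) : ℝ × ℝ × ℝ) := by
    funext q; rfl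
  rw [e, hc]
  rfl

/-- The time slice of a `Cⁿ` space–time structure function is `Cⁿ`. [folklore] -/
theorem contDiffAt_timeSlice {G : ℝ × ℝ × ℝ → ℝ} {t : ℝ} {p : ℝ × ℝ} {n : WithTop ℕ∞} (hG : ContDiffAt ℝ n G (t, p.1, p.2)) :
    ContDiffAt ℝ n (fun q : ℝ × ℝ => G (t, q.1, q.2)) p := by
  have hι : ContDiffAt ℝ n (fun q : ℝ × ℝ => ((t, q) : ℝ × ℝ × ℝ)) p := (contDiff_const.prodMk contDiff_id).contDiffAt
  exact hG.comp p hι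

/-! ### (K1): the divergence identity in structure-function currency -/

section Slice

variable {V : EuclideanSpace ℝ (Fin 3) → EuclideanSpace ℝ (Fin 3)} {P Λ : ℝ × ℝ → ℝ} {U : Set (EuclideanSpace ℝ (Fin 3))}

/-- `div V = ∂₀V₀ + ∂₁V₁ + ∂₂V₂` in coordinates: a divergence-free field has `Σᵢ (DV eᵢ)ᵢ = 0`. [folklore] -/
theorem sum_fderiv_apply_eq_zero_of_isDivFree (hdiv : VectorCalculus.IsDivFree V) (y : EuclideanSpace ℝ (Fin 3)) :
    fderiv ℝ V y (EuclideanSpace.single 0 1) 0 + fderiv ℝ V y (EuclideanSpace.single 1 1) 1 +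
      fderiv ℝ V y (EuclideanSpace.single 2 1) 2 = 0 := by
  have h := hdiv y
  rw [divergence_eq_sum_inner_fderiv (EuclideanSpace.basisFun (Fin 3) ℝ)] at h
  simpa [Fin.sum_univ_three, EuclideanSpace.basisFun_apply, EuclideanSpace.inner_single_left, add_assoc] using h

/-- **(K1) — the height-derivative of `div v = 0` in structure-function currency.**  Let `V ∈ C²(ℝ³; ℝ³)` be divergence-free and, on an open
set `U`, let its vertical velocity `w = V₂` be untwisted, `∂₂w = P(w, y₂)`, and its shear leafwise-proportional, `∂₂V_b = Λ(w, y₂)·∂_b w`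
(`b = 0,1`), with `P, Λ` differentiable at the leaf points.  Then on `U`:  **`Λ·(∂₀∂₀w + ∂₁∂₁w) + Λ_w·((∂₀w)² + (∂₁w)²) + Ṗ = 0`**,
`Λ_w = DΛ(1,0)`, `Ṗ = DP(P,1)` (UNTWISTED-NOTE §1 (K1): `∂₂(∂_bV_b) = ∂_b(Λ∂_bw)`, `∂₂∂₂w = Ṗ`). [folklore] -/
theorem divIdentity_of_structureFunctions (hV : ContDiff ℝ 2 V) (hdiv : VectorCalculus.IsDivFree V) (hU : IsOpen U)
    (hPd : ∀ y ∈ U, DifferentiableAt ℝ P (V y 2, y 2)) (hΛd : ∀ y ∈ U, DifferentiableAt ℝ Λ (V y 2, y 2))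
    (hP : ∀ y ∈ U, fderiv ℝ (fun x => V x 2) y (EuclideanSpace.single 2 (1 : ℝ)) = P (V y 2, y 2))
    (hΛ : ∀ y ∈ U, ∀ b : Fin 3, b ≠ 2 →
      fderiv ℝ V y (EuclideanSpace.single 2 1) b = Λ (V y 2, y 2) * fderiv ℝ (fun x => V x 2) y (EuclideanSpace.single b (1 : ℝ)))
    {y : EuclideanSpace ℝ (Fin 3)} (hy : y ∈ U) :
    Λ (V y 2, y 2) *
        (fderiv ℝ (fun y' => fderiv ℝ (fun x => V x 2) y' (EuclideanSpace.single 0 (1 : ℝ))) y (EuclideanSpace.single 0 (1 : ℝ)) +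
          fderiv ℝ (fun y' => fderiv ℝ (fun x => V x 2) y' (EuclideanSpace.single 1 (1 : ℝ))) y (EuclideanSpace.single 1 (1 : ℝ))) +
      fderiv ℝ Λ (V y 2, y 2) (1, 0) *
        (fderiv ℝ (fun x => V x 2) y (EuclideanSpace.single 0 (1 : ℝ)) ^ 2 + fderiv ℝ (fun x => V x 2) y (EuclideanSpace.single 1 (1 : ℝ)) ^ 2) +
      fderiv ℝ P (V y 2, y 2) (P (V y 2, y 2), 1) = 0 := by
  set w : EuclideanSpace ℝ (Fin 3) → ℝ := fun x => V x 2 with hw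
  have hwc : ContDiff ℝ 2 w := contDiff_coord hV 2
  have hVb : ∀ b : Fin 3, ContDiff ℝ 2 (fun x => V x b) := fun b => contDiff_coord hV b
  have hVd : Differentiable ℝ V := hV.differentiable (by norm_num)
  have hwd : Differentiable ℝ w := hwc.differentiable (by norm_num)
  -- the three diagonal partials
  set D0 : EuclideanSpace ℝ (Fin 3) → ℝ := fun y' => fderiv ℝ (fun x => V x 0) y' (EuclideanSpace.single 0 (1 : ℝ)) with hD0
  set D1 : EuclideanSpace ℝ (Fin 3) → ℝ := fun y' => fderiv ℝ (fun x => V x 1) y' (EuclideanSpace.single 1 (1 : ℝ)) with hD1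
  set D2 : EuclideanSpace ℝ (Fin 3) → ℝ := fun y' => fderiv ℝ w y' (EuclideanSpace.single 2 (1 : ℝ)) with hD2
  have hsum : (fun y' => D0 y' + D1 y' + D2 y') = fun _ => (0 : ℝ) := by
    funext y'
    have h := sum_fderiv_apply_eq_zero_of_isDivFree hdiv y'
    rw [← fderiv_coord_apply (hVd y') 0 (EuclideanSpace.single 0 1), ← fderiv_coord_apply (hVd y') 1 (EuclideanSpace.single 1 1),
      ← fderiv_coord_apply (hVd y') 2 (EuclideanSpace.single 2 1)] at h
    exact h
  have hD0d : DifferentiableAt ℝ D0 y := differentiableAt_partial (hVb 0) _ y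
  have hD1d : DifferentiableAt ℝ D1 y := differentiableAt_partial (hVb 1) _ y
  have hD2d : DifferentiableAt ℝ D2 y := differentiableAt_partial hwc _ y
  have hzero : fderiv ℝ D0 y (EuclideanSpace.single 2 (1 : ℝ)) + fderiv ℝ D1 y (EuclideanSpace.single 2 (1 : ℝ)) +
      fderiv ℝ D2 y (EuclideanSpace.single 2 (1 : ℝ)) = 0 := by
    have h1 : fderiv ℝ (fun y' => D0 y' + D1 y' + D2 y') y (EuclideanSpace.single 2 (1 : ℝ)) = 0 := by
      rw [hsum, fderiv_fun_const]; rfl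
    have h01 : DifferentiableAt ℝ (fun y' => D0 y' + D1 y') y := hD0d.add hD1d
    rw [fderiv_fun_add h01 hD2d, fderiv_fun_add hD0d hD1d] at h1
    simpa using h1
  -- the horizontal diagonal terms: `∂₂(∂_bV_b) = ∂_b(Λ ∂_b w) = Λ ∂_b∂_b w + Λ_w (∂_b w)²`
  have hdiag : ∀ b : Fin 3, b ≠ 2 →
      fderiv ℝ (fun y' => fderiv ℝ (fun x => V x b) y' (EuclideanSpace.single b (1 : ℝ))) y (EuclideanSpace.single 2 (1 : ℝ)) =
        Λ (V y 2, y 2) * fderiv ℝ (fun y' => fderiv ℝ w y' (EuclideanSpace.single b (1 : ℝ))) y (EuclideanSpace.single b (1 : ℝ)) +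
          fderiv ℝ Λ (V y 2, y 2) (1, 0) * fderiv ℝ w y (EuclideanSpace.single b (1 : ℝ)) ^ 2 := by
    intro b hb
    rw [fderiv_fderiv_symm (hVb b) y (EuclideanSpace.single b (1 : ℝ)) (EuclideanSpace.single 2 (1 : ℝ))]
    have hloc : (fun y' => fderiv ℝ (fun x => V x b) y' (EuclideanSpace.single 2 (1 : ℝ))) =ᶠ[𝓝 y]
        fun y' => Λ (w y', y' 2) * fderiv ℝ w y' (EuclideanSpace.single b (1 : ℝ)) := by
      filter_upwards [hU.mem_nhds hy] with y' hy'
      rw [fderiv_coord_apply (hVd y') b (EuclideanSpace.single 2 (1 : ℝ))]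
      exact hΛ y' hy' b hb
    rw [hloc.fderiv_eq]
    have hA : DifferentiableAt ℝ (fun y' : EuclideanSpace ℝ (Fin 3) => Λ (w y', y' 2)) y := differentiableAt_leaf_comp (hΛd y hy) (hwd y)
    rw [fderiv_mul_apply hA (differentiableAt_partial hwc _ y), fderiv_leaf_comp_horizontal (hΛd y hy) (hwd y) hb]
    ring
  -- the vertical diagonal term: `∂₂∂₂w = Ṗ`
  have hvert : fderiv ℝ D2 y (EuclideanSpace.single 2 (1 : ℝ)) = fderiv ℝ P (V y 2, y 2) (P (V y 2, y 2), 1) := by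
    rw [hD2]; exact fderiv_vert_vert hU hwc hPd hP hy
  have h0 := hdiag 0 (by decide)
  have h1 := hdiag 1 (by decide)
  rw [hvert] at hzero
  change fderiv ℝ (fun y' => fderiv ℝ (fun x => V x 0) y' (EuclideanSpace.single 0 (1 : ℝ))) y (EuclideanSpace.single 2 (1 : ℝ)) +
      fderiv ℝ (fun y' => fderiv ℝ (fun x => V x 1) y' (EuclideanSpace.single 1 (1 : ℝ))) y (EuclideanSpace.single 2 (1 : ℝ)) +
      fderiv ℝ P (V y 2, y 2) (P (V y 2, y 2), 1) = 0 at hzero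
  rw [h0, h1] at hzero
  linear_combination hzero

end Slice


/-! ### (Sz): the transport rule `∂₂S = P_w S + Λ E + P_t` for `S = v₀∂₀w + v₁∂₁w + ∂ₜw` -/

section Profile

variable {C : ℝ} {v : ℝ → EuclideanSpace ℝ (Fin 3) → EuclideanSpace ℝ (Fin 3)}

open Summit.NavierStokesRegularity.NavierStokesRegularity.Theorems.LocalSineTubeDoorProfileAlignedWindowRigidityAncient
open Summit.NavierStokesRegularity.NavierStokesRegularity.Theorems.PoloidalWindowDoorPoloidalWindowRigidityClebsch

/-- The vertical velocity `(τ, y) ↦ v₂(τ, y)` of a class profile is a jointly smooth scalar field on the slab. [folklore] -/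
theorem isSmoothSpaceTimeOn_vert (hrate : HasTypeITimeDecay C v)
    (hcont : ContinuousOn (uncurry v) (Iio (0 : ℝ) ×ˢ univ))
    (hmild : ∀ s t : ℝ, s < t → t < 0 → ∀ x,
      v t x = UnboundedOperators.heatExtension (v s) (t - s) x - oseenDuhamel 1 s v v t x) :
    IsSmoothSpaceTimeOn (Iio (0 : ℝ)) (fun τ y => v τ y 2) := by
  have hsm : ContDiffOn ℝ ∞ (uncurry v) (Iio (0 : ℝ) ×ˢ univ) :=
    (analyticOnNhd_uncurry hcont (bdd_of_hasTypeITimeDecay hrate) hmild).contDiffOn_of_completeSpace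
  exact ((EuclideanSpace.proj (2 : Fin 3) : EuclideanSpace ℝ (Fin 3) →L[ℝ] ℝ).contDiff.comp_contDiffOn hsm).congr
    fun q _ => by rcases q with ⟨s, z⟩; rfl

/-- The slice `y ↦ ∂ₜv₂(t, y)` (two-sided time derivative, `t < 0`) of a class profile is smooth. [folklore] -/
theorem contDiff_timeDeriv_vert (hrate : HasTypeITimeDecay C v)
    (hcont : ContinuousOn (uncurry v) (Iio (0 : ℝ) ×ˢ univ))
    (hmild : ∀ s t : ℝ, s < t → t < 0 → ∀ x,
      v t x = UnboundedOperators.heatExtension (v s) (t - s) x - oseenDuhamel 1 s v v t x) {t : ℝ} (ht : t < 0) :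
    ContDiff ℝ ∞ (fun y => deriv (fun τ => v τ y 2) t) := by
  have hS : UniqueDiffOn ℝ (Iio (0 : ℝ)) := isOpen_Iio.uniqueDiffOn
  have h := ((isSmoothSpaceTimeOn_vert hrate hcont hmild).timeDerivWithin hS).contDiff_slice ht
  have e1 : timeDerivWithin (Iio (0 : ℝ)) (fun τ y => v τ y 2) t = fun y' => deriv (fun τ => v τ y' 2) t := by
    funext y'; rw [timeDerivWithin_apply, derivWithin_of_isOpen isOpen_Iio ht]
  rw [e1] at h
  exact h

/-- **Mixed partials `∂₂∂ₜ = ∂ₜ∂₂` for the vertical velocity** of a class profile (`t < 0`, two-sided time derivatives):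
`∂₂[y ↦ ∂ₜv₂(t, y)] = ∂ₜ[τ ↦ ∂₂v₂(τ, y)]` (tree `IsSmoothSpaceTimeOn.timeDerivWithin_fderiv_slice_apply_of_uniqueDiffOn`). [folklore] -/
theorem fderiv_timeDeriv_vert (hrate : HasTypeITimeDecay C v)
    (hcont : ContinuousOn (uncurry v) (Iio (0 : ℝ) ×ˢ univ))
    (hmild : ∀ s t : ℝ, s < t → t < 0 → ∀ x,
      v t x = UnboundedOperators.heatExtension (v s) (t - s) x - oseenDuhamel 1 s v v t x) {t : ℝ} (ht : t < 0)
    (y : EuclideanSpace ℝ (Fin 3)) :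
    fderiv ℝ (fun y' => deriv (fun τ => v τ y' 2) t) y (EuclideanSpace.single 2 (1 : ℝ)) =
      deriv (fun τ => fderiv ℝ (fun x => v τ x 2) y (EuclideanSpace.single 2 (1 : ℝ))) t := by
  have hS : UniqueDiffOn ℝ (Iio (0 : ℝ)) := isOpen_Iio.uniqueDiffOn
  have h := (isSmoothSpaceTimeOn_vert hrate hcont hmild).timeDerivWithin_fderiv_slice_apply_of_uniqueDiffOn hS ht y
    (EuclideanSpace.single 2 (1 : ℝ))
  have e1 : timeDerivWithin (Iio (0 : ℝ)) (fun τ y => v τ y 2) t = fun y' => deriv (fun τ => v τ y' 2) t := by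
    funext y'; rw [timeDerivWithin_apply, derivWithin_of_isOpen isOpen_Iio ht]
  rw [e1, timeDerivWithin_apply, derivWithin_of_isOpen isOpen_Iio ht] at h
  exact h.symm

/-- **(Sz) — THE TRANSPORT RULE `∂₂S = P_w·S + Λ·E + P_t`.**  Let `v` be a profile of the route's Type-I class, `t < 0`, and on an open
set `U` of the slice `t` let the vertical velocity `w = v₂(t,·)` be untwisted, `∂₂w = P(w, y₂)`, and the shear leafwise-proportional,
`∂₂v_b = Λ(w, y₂)·∂_bw` (`b = 0,1`), with `P` differentiable at the leaf points.  At a point `y ∈ U` where the time line of `∂₂v₂` has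
derivative `P_t + P_w·∂ₜw` (the time chain rule of a SPACE–TIME structure function `∂₂v₂ = P̃(τ, v₂, y₂)`, `P = P̃(t,·,·)`), the scalar
`S := v₀∂₀w + v₁∂₁w + ∂ₜw` satisfies **`∂₂S = P_w·S + Λ·((∂₀w)² + (∂₁w)²) + P_t`** (UNTWISTED-NOTE §3 / BRIEF-v5 (S5) `hSz`:
`∂₂v_b = Λ∂_bw`, `∂₂∂_bw = P_w∂_bw`, `∂₂∂ₜw = ∂ₜ∂₂w`). [folklore] -/
theorem transport_rule (hrate : HasTypeITimeDecay C v)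
    (hcont : ContinuousOn (uncurry v) (Iio (0 : ℝ) ×ˢ univ))
    (hmild : ∀ s t : ℝ, s < t → t < 0 → ∀ x,
      v t x = UnboundedOperators.heatExtension (v s) (t - s) x - oseenDuhamel 1 s v v t x)
    {t : ℝ} (ht : t < 0) {U : Set (EuclideanSpace ℝ (Fin 3))} (hU : IsOpen U) {P Λ : ℝ × ℝ → ℝ}
    (hPd : ∀ y ∈ U, DifferentiableAt ℝ P (v t y 2, y 2))
    (hP : ∀ y ∈ U, fderiv ℝ (fun x => v t x 2) y (EuclideanSpace.single 2 (1 : ℝ)) = P (v t y 2, y 2))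
    (hΛ : ∀ y ∈ U, ∀ b : Fin 3, b ≠ 2 →
      fderiv ℝ (v t) y (EuclideanSpace.single 2 1) b = Λ (v t y 2, y 2) * fderiv ℝ (fun x => v t x 2) y (EuclideanSpace.single b (1 : ℝ)))
    {y : EuclideanSpace ℝ (Fin 3)} (hy : y ∈ U) {Pt : ℝ}
    (hDt : HasDerivAt (fun τ => fderiv ℝ (fun x => v τ x 2) y (EuclideanSpace.single 2 (1 : ℝ)))
      (Pt + fderiv ℝ P (v t y 2, y 2) (1, 0) * deriv (fun τ => v τ y 2) t) t) :
    fderiv ℝ (fun y' => v t y' 0 * fderiv ℝ (fun x => v t x 2) y' (EuclideanSpace.single 0 (1 : ℝ)) +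
        v t y' 1 * fderiv ℝ (fun x => v t x 2) y' (EuclideanSpace.single 1 (1 : ℝ)) + deriv (fun τ => v τ y' 2) t) y
        (EuclideanSpace.single 2 (1 : ℝ)) =
      fderiv ℝ P (v t y 2, y 2) (1, 0) *
          (v t y 0 * fderiv ℝ (fun x => v t x 2) y (EuclideanSpace.single 0 (1 : ℝ)) +
            v t y 1 * fderiv ℝ (fun x => v t x 2) y (EuclideanSpace.single 1 (1 : ℝ)) + deriv (fun τ => v τ y 2) t) +
        Λ (v t y 2, y 2) *
          (fderiv ℝ (fun x => v t x 2) y (EuclideanSpace.single 0 (1 : ℝ)) ^ 2 + fderiv ℝ (fun x => v t x 2) y (EuclideanSpace.single 1 (1 : ℝ)) ^ 2) +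
        Pt := by
  have hV : ContDiff ℝ ∞ (v t) := contDiff_slice hrate hcont hmild ht
  have hVd : Differentiable ℝ (v t) := hV.differentiable (by simp)
  set w : EuclideanSpace ℝ (Fin 3) → ℝ := fun x => v t x 2 with hw
  have hw2 : ContDiff ℝ 2 w := (contDiff_coord hV 2).of_le (by norm_cast)
  have hvb : ∀ b : Fin 3, Differentiable ℝ (fun x => v t x b) := fun b =>
    (contDiff_coord hV b).differentiable (by simp)
  set Wt : EuclideanSpace ℝ (Fin 3) → ℝ := fun y' => deriv (fun τ => v τ y' 2) t with hWt
  have hWtd : Differentiable ℝ Wt := (contDiff_timeDeriv_vert hrate hcont hmild ht).differentiable (by simp)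
  have hd1 : ∀ a : EuclideanSpace ℝ (Fin 3), DifferentiableAt ℝ (fun y' => fderiv ℝ w y' a) y := fun a => differentiableAt_partial hw2 a y
  -- the pieces
  have hA0 : DifferentiableAt ℝ (fun y' => v t y' 0 * fderiv ℝ w y' (EuclideanSpace.single 0 (1 : ℝ))) y := (hvb 0 y).mul (hd1 _)
  have hA1 : DifferentiableAt ℝ (fun y' => v t y' 1 * fderiv ℝ w y' (EuclideanSpace.single 1 (1 : ℝ))) y := (hvb 1 y).mul (hd1 _)
  have hA01 : DifferentiableAt ℝ (fun y' => v t y' 0 * fderiv ℝ w y' (EuclideanSpace.single 0 (1 : ℝ)) +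
      v t y' 1 * fderiv ℝ w y' (EuclideanSpace.single 1 (1 : ℝ))) y := hA0.add hA1
  have hvz : ∀ b : Fin 3, b ≠ 2 → fderiv ℝ (fun y' => v t y' b) y (EuclideanSpace.single 2 (1 : ℝ)) =
      Λ (v t y 2, y 2) * fderiv ℝ w y (EuclideanSpace.single b (1 : ℝ)) := by
    intro b hb
    rw [fderiv_coord_apply (hVd y) b]
    exact hΛ y hy b hb
  have hwz : ∀ b : Fin 3, b ≠ 2 → fderiv ℝ (fun y' => fderiv ℝ w y' (EuclideanSpace.single b (1 : ℝ))) y (EuclideanSpace.single 2 (1 : ℝ)) =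
      fderiv ℝ P (w y, y 2) (1, 0) * fderiv ℝ w y (EuclideanSpace.single b (1 : ℝ)) := fun b hb =>
    fderiv_vert_hpartial hU hw2 hPd hP hy hb
  have hWz : fderiv ℝ Wt y (EuclideanSpace.single 2 (1 : ℝ)) = Pt + fderiv ℝ P (v t y 2, y 2) (1, 0) * Wt y := by
    rw [hWt, fderiv_timeDeriv_vert hrate hcont hmild ht y, hDt.deriv]
  rw [fderiv_fun_add hA01 hWtd.differentiableAt, fderiv_fun_add hA0 hA1]
  simp only [_root_.add_apply]
  rw [fderiv_mul_apply (hvb 0 y) (hd1 _), fderiv_mul_apply (hvb 1 y) (hd1 _), hvz 0 (by decide), hvz 1 (by decide),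
    hwz 0 (by decide), hwz 1 (by decide), hWz]
  ring

/-! ### (V0): the vertical momentum equation in structure-function currency -/

/-- **(V0) — THE DYNAMIC IDENTITY `(1−Λ)·S = (1−Λ)·M − Λ_w·E + k(w, y₂)`.**  Let `v` be a profile of the route's Type-I class, poloidal along
`e₃`, with its time-dependent Clebsch pair `φ, ψ` (`…StructureFunctionDynamics.linePotential_pair_spec`), `t < 0`, and on an open set `U` of
the slice `t`: the stream function is a structure function of the vertical velocity, `ψ(t,y) = F(v₂(t,y), y₂)` with `F` of class `C²` at the
leaf points (K2-p3's `exists_clebsch_eq_structureFunction`, sliced at `t`), and `w = v₂(t,·)` is untwisted, `∂₂w = P(w,y₂)`.  At a point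
`y ∈ U` where (i) the time line of `ψ` has derivative `F_t + F_w·∂ₜw`, (ii) `D(ψ t)(y) = F_w·Dw(y) + F_z·dy₂` and (iii) the dynamic scalar
`T = ∂ₜψ + (v·∇)ψ − Δψ` takes the value `τ(w, y₂)` (`exists_dynScalar_eq_leafwise`), one has, with `Λ := 1 − F_w`, `S := v₀∂₀w + v₁∂₁w + ∂ₜw`,
`E := (∂₀w)² + (∂₁w)²`, `M := ∂₀∂₀w + ∂₁∂₁w`:
**`(1 − Λ)·S = (1 − Λ)·M − Λ_w·E + k`**,  `k = τ − F_t − F_w·wP − w·F_z + F_w·Ṗ + F_ww·P² + (F_wz + F_zw)·P + F_zz` (all at `(w y, y₂)`) —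
UNTWISTED-NOTE §1 (V0) in the hypothesis format `hV0` of the lead's `…UntwistedSeparation2`.  Proof: expand `T = 𝓛[F(t, w, y₂)]` by the chain
rules (`hasDerivAt_time_…`, K2-p3's slice rule, `laplacian_of_leafwise`) and read off. [folklore] -/
theorem dynIdentity (hrate : HasTypeITimeDecay C v)
    (hcont : ContinuousOn (uncurry v) (Iio (0 : ℝ) ×ˢ univ))
    (hmild : ∀ s t : ℝ, s < t → t < 0 → ∀ x,
      v t x = UnboundedOperators.heatExtension (v s) (t - s) x - oseenDuhamel 1 s v v t x)
    (hdiv : ∀ t < 0, VectorCalculus.IsDivFree (v t))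
    (hpol : ∀ s < 0, ∀ y, ⟪curl (v s) y, EuclideanSpace.single 2 1⟫_ℝ = 0)
    {φ ψ : ℝ → EuclideanSpace ℝ (Fin 3) → ℝ}
    (hφ : φ = fun (t : ℝ) (x : EuclideanSpace ℝ (Fin 3)) =>
      ∫ σ in (0 : ℝ)..1, ⟪v t (σ • (x - x 2 • (EuclideanSpace.single (2 : Fin 3) (1 : ℝ))) +
        x 2 • (EuclideanSpace.single (2 : Fin 3) (1 : ℝ))), x - x 2 • (EuclideanSpace.single (2 : Fin 3) (1 : ℝ))⟫_ℝ)
    (hψ : ψ = fun t y => v t y 2 - fderiv ℝ (φ t) y (EuclideanSpace.single 2 1))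
    {t : ℝ} (ht : t < 0) {U : Set (EuclideanSpace ℝ (Fin 3))} (hU : IsOpen U) {F P τ Λ : ℝ × ℝ → ℝ}
    (hψF : ∀ y ∈ U, ψ t y = F (v t y 2, y 2)) (hFc : ∀ y ∈ U, ContDiffAt ℝ 2 F (v t y 2, y 2))
    (hPd : ∀ y ∈ U, DifferentiableAt ℝ P (v t y 2, y 2))
    (hP : ∀ y ∈ U, fderiv ℝ (fun x => v t x 2) y (EuclideanSpace.single 2 (1 : ℝ)) = P (v t y 2, y 2))
    (hΛF : Λ = fun q => 1 - fderiv ℝ F q (1, 0))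
    {y : EuclideanSpace ℝ (Fin 3)} (hy : y ∈ U) {Ft : ℝ}
    (hDt : HasDerivAt (fun τ' => ψ τ' y) (Ft + fderiv ℝ F (v t y 2, y 2) (1, 0) * deriv (fun τ' => v τ' y 2) t) t)
    (hDx : ∀ e : EuclideanSpace ℝ (Fin 3), fderiv ℝ (ψ t) y e =
      fderiv ℝ F (v t y 2, y 2) (1, 0) * fderiv ℝ (fun x => v t x 2) y e + e 2 * fderiv ℝ F (v t y 2, y 2) (0, 1))
    (hT : deriv (fun s => ψ s y) t + (convect (v t) (ψ t) y - Δ (ψ t) y) = τ (v t y 2, y 2)) :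
    (1 - Λ (v t y 2, y 2)) *
        (v t y 0 * fderiv ℝ (fun x => v t x 2) y (EuclideanSpace.single 0 (1 : ℝ)) +
          v t y 1 * fderiv ℝ (fun x => v t x 2) y (EuclideanSpace.single 1 (1 : ℝ)) + deriv (fun τ' => v τ' y 2) t) =
      (1 - Λ (v t y 2, y 2)) *
          (fderiv ℝ (fun y' => fderiv ℝ (fun x => v t x 2) y' (EuclideanSpace.single 0 (1 : ℝ))) y (EuclideanSpace.single 0 (1 : ℝ)) +
            fderiv ℝ (fun y' => fderiv ℝ (fun x => v t x 2) y' (EuclideanSpace.single 1 (1 : ℝ))) y (EuclideanSpace.single 1 (1 : ℝ))) -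
        fderiv ℝ Λ (v t y 2, y 2) (1, 0) *
          (fderiv ℝ (fun x => v t x 2) y (EuclideanSpace.single 0 (1 : ℝ)) ^ 2 + fderiv ℝ (fun x => v t x 2) y (EuclideanSpace.single 1 (1 : ℝ)) ^ 2) +
        (τ (v t y 2, y 2) - Ft - fderiv ℝ F (v t y 2, y 2) (1, 0) * (v t y 2 * P (v t y 2, y 2)) -
            v t y 2 * fderiv ℝ F (v t y 2, y 2) (0, 1) +
            fderiv ℝ F (v t y 2, y 2) (1, 0) * fderiv ℝ P (v t y 2, y 2) (P (v t y 2, y 2), 1) +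
            fderiv ℝ (fun q => fderiv ℝ F q ((1 : ℝ), (0 : ℝ))) (v t y 2, y 2) (1, 0) * P (v t y 2, y 2) ^ 2 +
            (fderiv ℝ (fun q => fderiv ℝ F q ((1 : ℝ), (0 : ℝ))) (v t y 2, y 2) (0, 1) +
                fderiv ℝ (fun q => fderiv ℝ F q ((0 : ℝ), (1 : ℝ))) (v t y 2, y 2) (1, 0)) * P (v t y 2, y 2) +
            fderiv ℝ (fun q => fderiv ℝ F q ((0 : ℝ), (1 : ℝ))) (v t y 2, y 2) (0, 1)) := by
  obtain ⟨-, -, hslice⟩ := linePotential_pair_spec hrate hcont hmild hdiv hpol hφ hψ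
  obtain ⟨-, hψsl, -⟩ := hslice t ht
  have hV : ContDiff ℝ ∞ (v t) := contDiff_slice hrate hcont hmild ht
  set w : EuclideanSpace ℝ (Fin 3) → ℝ := fun x => v t x 2 with hw
  have hw2 : ContDiff ℝ 2 w := (contDiff_coord hV 2).of_le (by norm_cast)
  have hψ2 : ContDiff ℝ 2 (ψ t) := hψsl.of_le (by norm_cast)
  -- the Laplacian of `ψ t` through the leaf chain rule, and `Δw = M + Ṗ`
  have hΔψ := laplacian_of_leafwise (f := ψ t) (w := w) (G := F) hU hψ2 hw2 hFc hψF hy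
  have hΔw : Δ w y = fderiv ℝ (fun y' => fderiv ℝ w y' (EuclideanSpace.single 0 (1 : ℝ))) y (EuclideanSpace.single 0 (1 : ℝ)) +
      fderiv ℝ (fun y' => fderiv ℝ w y' (EuclideanSpace.single 1 (1 : ℝ))) y (EuclideanSpace.single 1 (1 : ℝ)) +
      fderiv ℝ P (w y, y 2) (P (w y, y 2), 1) := by
    rw [Literature.Analysis.FluidPDE.Tsai2021.laplacian_eq_sum_three hw2 y, Fin.sum_univ_three, fderiv_vert_vert hU hw2 hPd hP hy]
  have hsq : ∑ i : Fin 3, fderiv ℝ w y (EuclideanSpace.single i (1 : ℝ)) ^ 2 =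
      fderiv ℝ w y (EuclideanSpace.single 0 (1 : ℝ)) ^ 2 + fderiv ℝ w y (EuclideanSpace.single 1 (1 : ℝ)) ^ 2 + P (w y, y 2) ^ 2 := by
    rw [Fin.sum_univ_three, hP y hy]
  -- the convective term
  have hconv : convect (v t) (ψ t) y = fderiv ℝ F (w y, y 2) (1, 0) *
      (v t y 0 * fderiv ℝ w y (EuclideanSpace.single 0 (1 : ℝ)) + v t y 1 * fderiv ℝ w y (EuclideanSpace.single 1 (1 : ℝ)) +
        v t y 2 * P (w y, y 2)) + v t y 2 * fderiv ℝ F (w y, y 2) (0, 1) := by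
    rw [convect_apply, hDx (v t y), fderiv_apply_eq_sum, Fin.sum_univ_three, hP y hy]
  -- the slope function
  have hΛv : Λ (w y, y 2) = 1 - fderiv ℝ F (w y, y 2) (1, 0) := by rw [hΛF]
  have hΛw : fderiv ℝ Λ (w y, y 2) (1, 0) = -fderiv ℝ (fun q => fderiv ℝ F q ((1 : ℝ), (0 : ℝ))) (w y, y 2) (1, 0) := by
    rw [hΛF, fderiv_const_sub]
    rfl
  rw [hΛv, hΛw]
  rw [hDt.deriv, hconv, hΔψ, hΔw, hsq, hP y hy] at hT
  linear_combination hT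

end Profile

end Summit.NavierStokesRegularity.NavierStokesRegularity.Theorems.PoloidalWindowDoorPoloidalWindowRigidityStructureFunctionNormalForm

end
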